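import Mathlib
import Summits.Ventures.PercRepro2.Independence
import Summits.Ventures.PercRepro2.Harris
import Summits.Ventures.PercRepro2.HCov
import Summits.Ventures.PercRepro2.CutVertexPaths
import Summits.Ventures.PercRepro2.CutOneFarConn
import Summits.Ventures.PercRepro2.CutTwoFarConn
import Summits.Ventures.PercRepro2.CutTwoFarLaw
import Summits.Ventures.PercRepro2.CutTwoFar
import Summits.Ventures.PercRepro2.CutTwoFarHarris
import Summits.Ventures.PercRepro2.CutTwoFarRootsLaw
import Summits.Ventures.PercRepro2.CutTwoFarRightPat
import Summits.Ventures.PercRepro2.BHKEvents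
import Summits.Ventures.PercRepro2.CutTwoFarRBConn
import Summits.Ventures.PercRepro2.CutTwoFarRBMasses
import Summits.Ventures.PercRepro2.CutTwoFarRB

/-!
# A root and `b` behind a cut vertex, IV: THE ENDPOINT NUMBER `γ(0)` IS NONNEGATIVE (blind cell
PercRepro2, typer-1 g50)

Of the four endpoint numbers of the T7 reduction (`CutTwoFarRB.lean`, MINE2-CUTVERTEX §13.8),
`γ(0) = 2[n₃ α + (n₃ₒ n_{x3} − n₃ β)] ≥ 0` by BHK06 Thm 1.3 in the same-cluster form with
avoidance (`bhk_same_cluster_events`, `s = a₂`, `t = a₃`: given `a₃ ∉ C(a₂)`, the events `o ∈ C(a₂)`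
and `v ∈ C(a₂)` are positively correlated, so `o ∈ C(a₂)` and `v ∉ C(a₂)` are negatively
correlated) — `gamma0_rb_nonneg`; hence **`HCov_a1bFar_of_three`**: (HCOV) on the class `{a₁, b}`
of S3.5 follows from `γ(1), h(0), h(1) ≥ 0` (mine-2: `γ(1)` by lemma (L) = `RootLeafB`, `h(0)`,
`h(1)` by the functional BHK — not matched here).  Own work; standard axioms.
-/

namespace Summit.Ventures.PercRepro2

open CovForm CutVertexM9 UnionCluster

namespace CutTwoFar

section RBSigns

variable {V : Type*} {E : Type*} [Fintype E] [DecidableEq E] {R : Type*} [Field R]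
variable {ends : E → Sym2 V} {side : E → Bool} {L : Set V} {v : V} {Rt : Set V}

variable [Fintype V] [DecidableEq V] [LinearOrder R] [IsStrictOrderedRing R]
variable (ends : E → Sym2 V) (v a₂ a₃ o : V) {p : E → R} (hp : IsProbVec p)
include hp

/-- BHK06 1.3, same cluster `C(a₂)` given `a₃ ∉ C(a₂)`:
`P(o ∈ C(a₂), a₃ ∉ C(a₂)) · P(v ∈ C(a₂), a₃ ∉ C(a₂)) ≤ P(o, v ∈ C(a₂), a₃ ∉ C(a₂)) · P(a₃ ∉ C(a₂))`. -/
lemma bhk_o_v_avoid3 :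
    prob p {ω | Conn ends ω o a₂ ∧ ¬ Conn ends ω a₃ a₂} * prob p {ω | Conn ends ω v a₂ ∧ ¬ Conn ends ω a₃ a₂} ≤
      prob p {ω | Conn ends ω o a₂ ∧ Conn ends ω v a₂ ∧ ¬ Conn ends ω a₃ a₂} * prob p {ω | ¬ Conn ends ω a₃ a₂} := by
  have key := bhk_same_cluster_events p hp ends a₂ a₃ (𝓤 := {S : Set V | o ∈ S})
    (𝓥 := {S : Set V | v ∈ S}) (fun _ _ hST h => hST h) (fun _ _ hST h => hST h)
  have e1 : clusterInEvent ends a₂ {S : Set V | o ∈ S} ∩ (connEvent ends a₂ a₃)ᶜ =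
      {ω : Config E | Conn ends ω o a₂ ∧ ¬ Conn ends ω a₃ a₂} := by
    ext ω
    simp only [Set.mem_inter_iff, Set.mem_compl_iff, clusterInEvent, Set.mem_setOf_eq, mem_cluster,
      mem_connEvent]
    exact ⟨fun ⟨h1, h2⟩ => ⟨conn_symm h1, fun hc => h2 (conn_symm hc)⟩,
      fun ⟨h1, h2⟩ => ⟨conn_symm h1, fun hc => h2 (conn_symm hc)⟩⟩
  have e2 : clusterInEvent ends a₂ {S : Set V | v ∈ S} ∩ (connEvent ends a₂ a₃)ᶜ =
      {ω : Config E | Conn ends ω v a₂ ∧ ¬ Conn ends ω a₃ a₂} := by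
    ext ω
    simp only [Set.mem_inter_iff, Set.mem_compl_iff, clusterInEvent, Set.mem_setOf_eq, mem_cluster,
      mem_connEvent]
    exact ⟨fun ⟨h1, h2⟩ => ⟨conn_symm h1, fun hc => h2 (conn_symm hc)⟩,
      fun ⟨h1, h2⟩ => ⟨conn_symm h1, fun hc => h2 (conn_symm hc)⟩⟩
  have e3 : clusterInEvent ends a₂ {S : Set V | o ∈ S} ∩ clusterInEvent ends a₂ {S : Set V | v ∈ S} ∩
      (connEvent ends a₂ a₃)ᶜ =
      {ω : Config E | Conn ends ω o a₂ ∧ Conn ends ω v a₂ ∧ ¬ Conn ends ω a₃ a₂} := by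
    ext ω
    simp only [Set.mem_inter_iff, Set.mem_compl_iff, clusterInEvent, Set.mem_setOf_eq, mem_cluster,
      mem_connEvent]
    exact ⟨fun ⟨⟨h1, h2⟩, h3⟩ => ⟨conn_symm h1, conn_symm h2, fun hc => h3 (conn_symm hc)⟩,
      fun ⟨h1, h2, h3⟩ => ⟨⟨conn_symm h1, conn_symm h2⟩, fun hc => h3 (conn_symm hc)⟩⟩
  have e4 : (connEvent ends a₂ a₃)ᶜ = {ω : Config E | ¬ Conn ends ω a₃ a₂} := by
    ext ω
    simp only [Set.mem_compl_iff, mem_connEvent, Set.mem_setOf_eq]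
    exact ⟨fun h hc => h (conn_symm hc), fun h hc => h (conn_symm hc)⟩
  rw [e1, e2, e3, e4] at key
  exact key

/-- **`γ(0) ≥ 0`** for the T7 reduction. -/
lemma gamma0_rb_nonneg : 0 ≤ 2 * (prob p {ω | ¬ Conn ends ω a₃ a₂} * prob p {ω | ¬ Conn ends ω v a₂ ∧ Conn ends ω o v ∧ Conn ends ω a₃ a₂} + (prob p {ω | Conn ends ω o a₂ ∧ ¬ Conn ends ω a₃ a₂} * prob p {ω | ¬ Conn ends ω v a₂ ∧ ¬ Conn ends ω a₃ a₂} - prob p {ω | ¬ Conn ends ω a₃ a₂} * prob p {ω | ¬ Conn ends ω v a₂ ∧ Conn ends ω o a₂ ∧ ¬ Conn ends ω a₃ a₂})) := by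
  have hB := bhk_o_v_avoid3 ends v a₂ a₃ o hp
  -- inclusion–exclusion: `n_x3 = n₃ − P(v ∈ C(a₂), a₃ ∉ C(a₂))`, `β = n₃ₒ − P(o, v ∈ C(a₂), a₃ ∉ C(a₂))`
  have i1 : prob p {ω | ¬ Conn ends ω v a₂ ∧ ¬ Conn ends ω a₃ a₂} = prob p {ω | ¬ Conn ends ω a₃ a₂} - prob p {ω | Conn ends ω v a₂ ∧ ¬ Conn ends ω a₃ a₂} := by
    have := prob_inter_add_prob_inter_compl p {ω : Config E | ¬ Conn ends ω a₃ a₂} (connEvent ends v a₂)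
    have s1 : {ω : Config E | ¬ Conn ends ω a₃ a₂} ∩ connEvent ends v a₂ =
        {ω | Conn ends ω v a₂ ∧ ¬ Conn ends ω a₃ a₂} := by
      ext ω
      simp only [Set.mem_inter_iff, Set.mem_setOf_eq, mem_connEvent]
      tauto
    have s2 : {ω : Config E | ¬ Conn ends ω a₃ a₂} ∩ (connEvent ends v a₂)ᶜ =
        {ω | ¬ Conn ends ω v a₂ ∧ ¬ Conn ends ω a₃ a₂} := by
      ext ω
      simp only [Set.mem_inter_iff, Set.mem_setOf_eq, mem_connEvent, Set.mem_compl_iff]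
      tauto
    rw [s1, s2] at this
    linarith
  have i2 : prob p {ω | ¬ Conn ends ω v a₂ ∧ Conn ends ω o a₂ ∧ ¬ Conn ends ω a₃ a₂} = prob p {ω | Conn ends ω o a₂ ∧ ¬ Conn ends ω a₃ a₂} -
      prob p {ω | Conn ends ω o a₂ ∧ Conn ends ω v a₂ ∧ ¬ Conn ends ω a₃ a₂} := by
    have := prob_inter_add_prob_inter_compl p
      {ω : Config E | Conn ends ω o a₂ ∧ ¬ Conn ends ω a₃ a₂} (connEvent ends v a₂)
    have s1 : {ω : Config E | Conn ends ω o a₂ ∧ ¬ Conn ends ω a₃ a₂} ∩ connEvent ends v a₂ =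
        {ω | Conn ends ω o a₂ ∧ Conn ends ω v a₂ ∧ ¬ Conn ends ω a₃ a₂} := by
      ext ω
      simp only [Set.mem_inter_iff, Set.mem_setOf_eq, mem_connEvent]
      tauto
    have s2 : {ω : Config E | Conn ends ω o a₂ ∧ ¬ Conn ends ω a₃ a₂} ∩ (connEvent ends v a₂)ᶜ =
        {ω | ¬ Conn ends ω v a₂ ∧ Conn ends ω o a₂ ∧ ¬ Conn ends ω a₃ a₂} := by
      ext ω
      simp only [Set.mem_inter_iff, Set.mem_setOf_eq, mem_connEvent, Set.mem_compl_iff]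
      tauto
    rw [s1, s2] at this
    linarith
  have h0 := prob_nonneg hp {ω : Config E | ¬ Conn ends ω a₃ a₂}
  have hα := prob_nonneg hp {ω : Config E | ¬ Conn ends ω v a₂ ∧ Conn ends ω o v ∧ Conn ends ω a₃ a₂}
  rw [i1, i2]
  nlinarith [mul_nonneg h0 hα]

end RBSigns

/-! ## (HCOV) on the class from the three remaining endpoint numbers -/

section RBClass

variable {V : Type*} {E : Type*} [Fintype E] [DecidableEq E] {R : Type*} [Field R]
variable {ends : E → Sym2 V} {side : E → Bool} {L : Set V} {v : V} {Rt : Set V}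
variable [Fintype V] [DecidableEq V] [LinearOrder R] [IsStrictOrderedRing R]
variable (h : CutVertex ends side L v Rt) {o b a₁ a₂ a₃ : V} (p : E → R)
include h

/-- **(HCOV) with a root and `b` behind a cut vertex, from `γ(1), h(0), h(1) ≥ 0`.** -/
theorem HCov_a1bFar_of_three (h1 : a₁ ∈ L ∨ a₁ = v) (hb : b ∈ L ∨ b = v) (h2 : a₂ ∈ Rt ∨ a₂ = v)
    (h3 : a₃ ∈ Rt ∨ a₃ = v) (ho : o ∈ Rt ∨ o = v) (hp : IsProbVec p) (hg1 : 0 ≤ 2 * (prob p {ω | ¬ Conn ends ω v a₂ ∧ ¬ (Conn ends ω a₃ v ∨ Conn ends ω a₃ a₂)} * (prob p {ω | ¬ Conn ends ω v a₂ ∧ Conn ends ω o v ∧ Conn ends ω a₃ a₂} - prob p {ω | ¬ Conn ends ω v a₂ ∧ Conn ends ω o a₂ ∧ ¬ Conn ends ω a₃ a₂}) + prob p {ω | ¬ Conn ends ω v a₂} * prob p {ω | ¬ Conn ends ω v a₂ ∧ ¬ (Conn ends ω a₃ v ∨ Conn ends ω a₃ a₂)} * prob p {ω | Conn ends ω o a₂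 ∧ ¬ Conn ends ω a₃ a₂} + prob p {ω | ¬ Conn ends ω v a₂ ∧ ¬ (Conn ends ω a₃ v ∨ Conn ends ω a₃ a₂) ∧ (Conn ends ω o v ∨ Conn ends ω o a₂)} * (prob p {ω | ¬ Conn ends ω v a₂} * prob p {ω | Conn ends ω a₃ a₂} - prob p {ω | ¬ Conn ends ω v a₂ ∧ Conn ends ω a₃ a₂})))
    (hh0 : 0 ≤ 2 * prob p {ω | Conn ends ω v a₂} * (prob p {ω | ¬ Conn ends ω a₃ a₂} * (prob p {ω | ¬ Conn ends ω v a₂ ∧ Conn ends ω o v ∧ ¬ (Conn ends ω a₃ v ∨ Conn ends ω a₃ a₂)} + prob p {ω | ¬ Conn ends ω v a₂ ∧ Conn ends ω o v ∧ Conn ends ω a₃ a₂}) + prob p {ω | Conn ends ω o a₂ ∧ ¬ Conn ends ω a₃ a₂} * prob p {ω | ¬ Conn ends ω v a₂ ∧ Conn ends ω a₃ v} - prob p {ω | ¬ Conn ends ω a₃ a₂} * prob p {ω | ¬ Conn ends ω v a₂ ∧ Conn ends ω o a₂ ∧ Conn ends ω a₃ v})) (hh1 : 0 ≤ 2 * prob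 p {ω | Conn ends ω v a₂} * (prob p {ω | ¬ Conn ends ω v a₂ ∧ ¬ (Conn ends ω a₃ v ∨ Conn ends ω a₃ a₂) ∧ (Conn ends ω o v ∨ Conn ends ω o a₂)} * prob p {ω | ¬ Conn ends ω v a₂ ∧ ¬ Conn ends ω a₃ a₂} + prob p {ω | ¬ Conn ends ω v a₂ ∧ ¬ (Conn ends ω a₃ v ∨ Conn ends ω a₃ a₂)} * (prob p {ω | ¬ Conn ends ω v a₂ ∧ Conn ends ω o v ∧ Conn ends ω a₃ a₂} - prob p {ω | ¬ Conn ends ω v a₂ ∧ Conn ends ω o a₂ ∧ ¬ Conn ends ω a₃ a₂}))) : HCov p ends o a₁ a₂ a₃ b :=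
  HCov_a1bFar_of_endpoints h p h1 hb h2 h3 ho hp (gamma0_rb_nonneg ends v a₂ a₃ o hp) hg1 hh0 hh1

end RBClass

end CutTwoFar

end Summit.Ventures.PercRepro2
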